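import Summits.AtomisticToContinuum.FouriersLaw.Theses.MatthiessenLadder
import Summits.AtomisticToContinuum.FouriersLaw.Theorems.JunctionLocalityHarmonicCalibration
import HarnessLib

/-!
# Stub R₀ `stub_prefixResponseZero` of crux `PrefixSteadyStates` (line `registered`, reshape r2):
# the `k = 0` (harmonic) rung has an explicit response coefficient

`--supports stmt-AtomisticToContinuum-12778`. The rung `cellChain ω₂ lam β γ (· < 0)` is the pinned
harmonic host `pinnedChain ω₂ 0 0 γ` (`cellChain_const_false`, after `decide (i < 0) = false`), whose
Gaussian steady-state family `harmonicNESS ω₂ γ N` carries the total current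
`(N-1)·fluxCoeff ω₂ γ N·(T_L - T_R)` (`totalCurrent_harmonicNESS`). Hence `D = (N-1)·fluxCoeff ω₂ γ N`
is a response coefficient (`SiteChain.IsResponseCoeff`) at every `N` and `T > 0` — along SOME
steady-state family, as the predicate asks, so WITHOUT any uniqueness hypothesis (proved by the
wave-1 response worker; landed by the lead).
-/

noncomputable section

namespace Summit.AtomisticToContinuum.FouriersLaw.Theorems.PrefixSteadyStates.LineRegistered

open MeasureTheory Filter Topology Set
open scoped NNReal ENNReal ContDiff
open Literature.MathematicalPhysics.KineticTheory.HeatConduction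

/-- **The `k = 0` rung has an explicit response coefficient.** For `ω₂, γ > 0`, every `lam, β`,
every size `N` and every `T > 0`, `D = (N-1)·fluxCoeff ω₂ γ N` is a response coefficient of
`cellChain ω₂ lam β γ (· < 0) = pinnedChain ω₂ 0 0 γ` along the Gaussian family `harmonicNESS`.
[cite: BonettoLebowitzReyBellet2000, §6.2] -/
theorem prefixResponse_zero {ω₂ γ : ℝ} (hω : 0 < ω₂) (hγ : 0 < γ) (lam β : ℝ) (N : ℕ) {T : ℝ}
    (hT : 0 < T) :
    (cellChain ω₂ lam β γ (fun i => decide (i < 0))).IsResponseCoeff N T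
      (((N : ℝ) - 1) * fluxCoeff ω₂ γ N) := by
  have h0 : (fun i : ℕ => decide (i < 0)) = fun _ => false := by
    funext i; simp
  rw [h0, cellChain_const_false]
  refine ⟨fun T_L T_R => harmonicNESS ω₂ γ N T_L T_R,
    fun T_L T_R hL hR => isSteadyState_harmonicNESS hω hγ N hL hR, ?_⟩
  have h1 : ∀ᶠ δ in 𝓝 (0 : ℝ), |δ| < 2 * T := by
    have : ∀ᶠ δ in 𝓝 (0 : ℝ), δ ∈ Ioo (-(2 * T)) (2 * T) :=
      Ioo_mem_nhds (by linarith) (by linarith)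
    filter_upwards [this] with δ hδ
    exact abs_lt.2 ⟨hδ.1, hδ.2⟩
  refine (tendsto_const_nhds (x := ((N : ℝ) - 1) * fluxCoeff ω₂ γ N)).congr' ?_
  filter_upwards [mem_nhdsWithin_of_mem_nhds h1, self_mem_nhdsWithin] with δ hδ hδ0
  have hδ' := abs_lt.1 hδ
  have hδ0' : δ ≠ 0 := hδ0
  rw [OscillatorChain.toSiteChain_totalCurrent,
    JunctionLocality.totalCurrent_harmonicNESS hω hγ N (by linarith) (by linarith)]
  field_simp
  ring

/-- **Registered stub `stub_prefixResponseZero`** (crux `PrefixSteadyStates`, line `registered`,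
reshape r2): the harmonic rung has a response coefficient at every `N` and `T > 0`.
[cite: BonettoLebowitzReyBellet2000, §6.2] -/
theorem stub_prefixResponseZero :
    ∀ ω₂ lam β γ : ℝ, 0 < ω₂ → 0 < γ → ∀ (N : ℕ) (T : ℝ), 0 < T →
      ∃ D : ℝ, (cellChain ω₂ lam β γ (fun i => decide (i < 0))).IsResponseCoeff N T D :=
  fun _ lam β _ hω hγ N _ hT => ⟨_, prefixResponse_zero hω hγ lam β N hT⟩

end Summit.AtomisticToContinuum.FouriersLaw.Theorems.PrefixSteadyStates.LineRegistered

end
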